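import Mathlib
import Summits.NavierStokesRegularity.NavierStokesRegularity.Theses.WakeRatchet
import Summits.NavierStokesRegularity.NavierStokesRegularity.Theorems.WakeRatchetEternalViscousRateDissipativeRung
import Summits.NavierStokesRegularity.NavierStokesRegularity.Theorems.WakeRatchetTailEnvelopeFinite
import HarnessLib

set_option linter.dupNamespace false

/-!
# No one-sided eternal solutions: a bounded admissible (viscous or inviscid) eternal solution of the
# renormalised lattice that vanishes on all shells `k ≤ N` vanishes identically

Evidence file (ns-idea-1 g9; answers the class raised in idea-crit-3 g0's price P0 on WakeRatchet: the rate
cruxes K1/K1ᵛ demand strict contraction at the support edge, which forces `W ≡ 0` on half-line-supported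
solutions — here that class is shown to be EMPTY anyway, so the edge case carries no content).
Mechanism: the PHYSICAL energy of the finite tail above `N`, `T_M(σ) = Σ_{j<M} E_{N+1+j}(σ)`
(`E_k = physEnergy = Λ^{-2k} e^{2σ}‖W_k‖²`), has `T_M' = F_N − F_{N+M} − dissipation` (tree
`hasDerivAt_tail`); `F_N = 0` because shell `N` is empty, `|F_{N+M}| ≤ κ_M e^{2σ}` with `κ_M → 0`
geometrically (uniform bound), and `T_M(σ) ≤ S_M e^{2σ} → 0` as `σ → −∞`.  Hence `T_M ≡ 0`.
MODEL lattice only; sorry-free. No summit is proved by a line.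
-/

namespace Summit.NavierStokesRegularity.NavierStokesRegularity.Cruxes.EternalViscousRate.DissipationEdge

open Literature.Analysis.FluidPDE.TaoCascade
open Summit.NavierStokesRegularity.NavierStokesRegularity.Theorems.TailEnvelopeFinite (hasDerivAt_exp_two_mul')

variable {ε₀ νh : ℝ} {α : Fin 4 → Fin 4 → Fin 4 → ℤ × ℤ × ℤ → ℝ} {W : ℤ → ℝ → Em 4}

/-- A vanishing shell value has zero physical energy. -/
theorem physEnergy_eq_zero_of_eq_zero {k : ℤ} {σ : ℝ} (h : W k σ = 0) :
    physEnergy ε₀ W k σ = 0 := by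
  simp [physEnergy, h]

/-- A uniform bound on the shells bounds each physical energy. -/
theorem physEnergy_le_of_bound {B : ℝ} (hB : ∀ (k : ℤ) (σ : ℝ), ‖W k σ‖ ≤ B) (k : ℤ) (σ : ℝ) :
    physEnergy ε₀ W k σ ≤ (bigLam ε₀ ^ k)⁻¹ ^ 2 * (Real.exp (2 * σ) * B ^ 2) := by
  unfold physEnergy
  have h1 : ‖W k σ‖ ^ 2 ≤ B ^ 2 := pow_le_pow_left₀ (norm_nonneg _) (hB k σ) 2
  have h2 : Real.exp (2 * σ) * ‖W k σ‖ ^ 2 ≤ Real.exp (2 * σ) * B ^ 2 :=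
    mul_le_mul_of_nonneg_left h1 (Real.exp_pos _).le
  exact mul_le_mul_of_nonneg_left h2 (by positivity)

/-- Zero physical energy forces the shell value to vanish. -/
theorem eq_zero_of_physEnergy_eq_zero (hε : 0 < ε₀) {k : ℤ} {σ : ℝ}
    (h : physEnergy ε₀ W k σ = 0) : W k σ = 0 := by
  have hΛ : 0 < bigLam ε₀ := bigLam_pos (by linarith)
  unfold physEnergy at h
  have h1 : (bigLam ε₀ ^ k)⁻¹ ^ 2 ≠ 0 := by positivity
  have h2 : Real.exp (2 * σ) ≠ 0 := (Real.exp_pos _).ne'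
  have h3 : ‖W k σ‖ ^ 2 = 0 := by
    rcases mul_eq_zero.1 h with h | h
    · exact absurd h h1
    rcases mul_eq_zero.1 h with h | h
    · exact absurd h h2
    · exact h
  have : ‖W k σ‖ = 0 := pow_eq_zero_iff (n := 2) (by norm_num) |>.1 h3
  exact norm_eq_zero.1 this

/-- **No one-sided bounded eternal solutions.** -/
theorem eq_zero_of_vanish_below (hε : 0 < ε₀) (hW : IsEternalVisc ε₀ νh α W)
    (hc : IsCancellingCoeff α) (hU : UniformBound W) {N : ℤ}
    (hz : ∀ k : ℤ, k ≤ N → ∀ σ : ℝ, W k σ = 0) :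
    ∀ (n : ℤ) (σ : ℝ), W n σ = 0 := by
  obtain ⟨B, hB⟩ := hU
  have hB0 : 0 ≤ B := (norm_nonneg _).trans (hB 0 0)
  have hΛ : 0 < bigLam ε₀ := bigLam_pos (by linarith)
  have hΛne : bigLam ε₀ ≠ 0 := hΛ.ne'
  have hΛ1 : 1 < bigLam ε₀ := one_lt_bigLam hε
  have hCA : 0 ≤ fluxConst α := fluxConst_nonneg α
  -- the finite tails, their slope constants and their far-past constants
  set T : ℕ → ℝ → ℝ := fun M x => ∑ j ∈ Finset.range M, physEnergy ε₀ W (N + 1 + j) x with hTdef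
  set κ : ℕ → ℝ := fun M =>
    2 * fluxConst α * (bigLam ε₀)⁻¹ * B * ((bigLam ε₀ ^ (N + (M : ℤ)))⁻¹ ^ 2 * B ^ 2) with hκdef
  set S : ℕ → ℝ := fun M =>
    ∑ j ∈ Finset.range M, (bigLam ε₀ ^ (N + 1 + (j : ℤ)))⁻¹ ^ 2 * B ^ 2 with hSdef
  have hκ0 : ∀ M, 0 ≤ κ M := fun M => by positivity
  have hS0 : ∀ M, 0 ≤ S M := fun M => Finset.sum_nonneg fun j _ => by positivity
  have hT0 : ∀ M x, 0 ≤ T M x := fun M x =>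
    Finset.sum_nonneg fun j _ => physEnergy_nonneg ε₀ W _ _
  have hTmono : ∀ {M M' : ℕ}, M ≤ M' → ∀ x, T M x ≤ T M' x := by
    intro M M' h x
    exact Finset.sum_le_sum_of_subset_of_nonneg (Finset.range_mono h)
      (fun j _ _ => physEnergy_nonneg ε₀ W _ _)
  -- (1) the empty shell `N` carries no flux
  have hFN : ∀ σ, physFlux ε₀ α W N σ = 0 := by
    intro σ
    have h := abs_physFlux_le hε hc W N σ
    rw [physEnergy_eq_zero_of_eq_zero (hz N le_rfl σ), mul_zero] at h
    exact abs_nonpos_iff.1 h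
  have hvisc : ∀ (k : ℤ) (σ : ℝ), 0 ≤ viscCoef ε₀ νh k σ := by
    intro k σ
    have := hW.nonneg
    unfold viscCoef
    positivity
  -- (2) slope bound: T_M' ≤ κ_M e^{2σ}
  have hslope : ∀ (M : ℕ) (σ : ℝ),
      physFlux ε₀ α W N σ - physFlux ε₀ α W (N + M) σ
        - ∑ j ∈ Finset.range M, 2 * viscCoef ε₀ νh (N + 1 + j) σ * physEnergy ε₀ W (N + 1 + j) σ
        ≤ κ M * Real.exp (2 * σ) := by
    intro M σ
    have hdiss : 0 ≤ ∑ j ∈ Finset.range M,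
        2 * viscCoef ε₀ νh (N + 1 + j) σ * physEnergy ε₀ W (N + 1 + j) σ :=
      Finset.sum_nonneg fun j _ => by
        have := hvisc (N + 1 + j) σ
        have := physEnergy_nonneg ε₀ W (N + 1 + j) σ
        positivity
    have h1 : -physFlux ε₀ α W (N + M) σ ≤ |physFlux ε₀ α W (N + M) σ| := neg_le_abs _
    have h2 := abs_physFlux_le hε hc W (N + M) σ
    have h3 : ‖W (N + M + 1) σ‖ ≤ B := hB _ _
    have h4 := physEnergy_le_of_bound (ε₀ := ε₀) hB (N + M) σ
    have hE0 := physEnergy_nonneg ε₀ W (N + M) σ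
    have h5 : 2 * fluxConst α * (bigLam ε₀)⁻¹ * ‖W (N + M + 1) σ‖ * physEnergy ε₀ W (N + M) σ
        ≤ 2 * fluxConst α * (bigLam ε₀)⁻¹ * B
            * ((bigLam ε₀ ^ (N + (M : ℤ)))⁻¹ ^ 2 * (Real.exp (2 * σ) * B ^ 2)) := by
      have ha : 0 ≤ 2 * fluxConst α * (bigLam ε₀)⁻¹ := by positivity
      calc 2 * fluxConst α * (bigLam ε₀)⁻¹ * ‖W (N + M + 1) σ‖ * physEnergy ε₀ W (N + M) σ
          ≤ 2 * fluxConst α * (bigLam ε₀)⁻¹ * B * physEnergy ε₀ W (N + M) σ := by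
            gcongr
        _ ≤ 2 * fluxConst α * (bigLam ε₀)⁻¹ * B
            * ((bigLam ε₀ ^ (N + (M : ℤ)))⁻¹ ^ 2 * (Real.exp (2 * σ) * B ^ 2)) := by
            gcongr
    have h6 : 2 * fluxConst α * (bigLam ε₀)⁻¹ * B
            * ((bigLam ε₀ ^ (N + (M : ℤ)))⁻¹ ^ 2 * (Real.exp (2 * σ) * B ^ 2))
        = κ M * Real.exp (2 * σ) := by
      simp only [hκdef]; ring
    rw [hFN σ]
    linarith
  -- (3) T_M(x) − (κ_M/2) e^{2x} is non-increasing
  have hanti : ∀ M : ℕ, Antitone (fun x => T M x - κ M / 2 * Real.exp (2 * x)) := by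
    intro M
    have hd : ∀ x, HasDerivAt (fun x => T M x - κ M / 2 * Real.exp (2 * x))
        (physFlux ε₀ α W N x - physFlux ε₀ α W (N + M) x
          - ∑ j ∈ Finset.range M, 2 * viscCoef ε₀ νh (N + 1 + j) x * physEnergy ε₀ W (N + 1 + j) x
          - κ M / 2 * (2 * Real.exp (2 * x))) x := by
      intro x
      exact (hasDerivAt_tail hε hW hc N M x).sub ((hasDerivAt_exp_two_mul' x).const_mul _)
    refine antitone_of_deriv_nonpos (fun x => (hd x).differentiableAt) fun x => ?_
    rw [(hd x).deriv]
    have := hslope M x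
    nlinarith [hκ0 M, Real.exp_pos (2 * x)]
  -- (4) far past: T_M(x) ≤ S_M e^{2x}
  have hfar : ∀ (M : ℕ) (x : ℝ), T M x ≤ S M * Real.exp (2 * x) := by
    intro M x
    have : T M x ≤ ∑ j ∈ Finset.range M,
        (bigLam ε₀ ^ (N + 1 + (j : ℤ)))⁻¹ ^ 2 * (Real.exp (2 * x) * B ^ 2) :=
      Finset.sum_le_sum fun j _ => physEnergy_le_of_bound hB _ _
    refine this.trans (le_of_eq ?_)
    simp only [hSdef, Finset.sum_mul]
    refine Finset.sum_congr rfl fun j _ => ?_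
    ring
  -- (5) T_M(σ₁) ≤ (κ_M/2) e^{2σ₁}
  have hbound : ∀ (M : ℕ) (σ₁ : ℝ), T M σ₁ ≤ κ M / 2 * Real.exp (2 * σ₁) := by
    intro M σ₁
    refine le_of_forall_pos_le_add fun δ hδ => ?_
    -- choose σ₀ ≤ σ₁ with S_M e^{2σ₀} ≤ δ
    set σ₀ : ℝ := min σ₁ (Real.log (δ / (S M + 1)) / 2) with hσ₀def
    have hσ₀le : σ₀ ≤ σ₁ := min_le_left _ _
    have hq : 0 < δ / (S M + 1) := div_pos hδ (by linarith [hS0 M])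
    have hexp : Real.exp (2 * σ₀) ≤ δ / (S M + 1) := by
      have : 2 * σ₀ ≤ Real.log (δ / (S M + 1)) := by
        have := min_le_right σ₁ (Real.log (δ / (S M + 1)) / 2)
        linarith
      calc Real.exp (2 * σ₀) ≤ Real.exp (Real.log (δ / (S M + 1))) := Real.exp_le_exp.2 this
        _ = δ / (S M + 1) := Real.exp_log hq
    have hfar' : T M σ₀ ≤ δ := by
      have h1 := hfar M σ₀
      have h2 : S M * Real.exp (2 * σ₀) ≤ S M * (δ / (S M + 1)) :=
        mul_le_mul_of_nonneg_left hexp (hS0 M)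
      have h3 : S M * (δ / (S M + 1)) ≤ δ := by
        rw [mul_div_assoc']
        rw [div_le_iff₀ (by linarith [hS0 M])]
        nlinarith [hS0 M]
      linarith
    have hmono := hanti M hσ₀le
    -- T σ₁ - κ/2 e^{2σ₁} ≤ T σ₀ - κ/2 e^{2σ₀} ≤ T σ₀ ≤ δ
    have : κ M / 2 * Real.exp (2 * σ₀) ≥ 0 := by have := hκ0 M; positivity
    simp only at hmono
    linarith
  -- (6) κ_{M'} → 0, hence T_M(σ₁) ≤ 0
  have hκ_eq : ∀ M' : ℕ, κ M' = (2 * fluxConst α * (bigLam ε₀)⁻¹ * B * ((bigLam ε₀ ^ N)⁻¹ ^ 2 * B ^ 2))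
      * (((bigLam ε₀)⁻¹) ^ 2) ^ M' := by
    intro M'
    simp only [hκdef]
    rw [zpow_add₀ hΛne, zpow_natCast, mul_inv, mul_pow, inv_pow, inv_pow, ← pow_mul, ← pow_mul,
      mul_comm 2 M']
    ring
  have hr1 : ((bigLam ε₀)⁻¹) ^ 2 < 1 := by
    have h1 : (bigLam ε₀)⁻¹ < 1 := inv_lt_one_of_one_lt₀ hΛ1
    have h0 : 0 ≤ (bigLam ε₀)⁻¹ := by positivity
    nlinarith
  have hr0 : 0 ≤ ((bigLam ε₀)⁻¹) ^ 2 := by positivity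
  have hTle0 : ∀ (M : ℕ) (σ₁ : ℝ), T M σ₁ ≤ 0 := by
    intro M σ₁
    refine le_of_forall_pos_le_add fun δ hδ => ?_
    rw [zero_add]
    set K₀ : ℝ := 2 * fluxConst α * (bigLam ε₀)⁻¹ * B * ((bigLam ε₀ ^ N)⁻¹ ^ 2 * B ^ 2) with hK₀
    have hK₀0 : 0 ≤ K₀ := by positivity
    -- pick n with r^n < δ / ((K₀/2) e^{2σ₁} + 1)
    have hq : 0 < δ / (K₀ / 2 * Real.exp (2 * σ₁) + 1) := by positivity
    obtain ⟨n, hn⟩ := exists_pow_lt_of_lt_one hq hr1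
    set M' : ℕ := max M n with hM'
    have hrM' : (((bigLam ε₀)⁻¹) ^ 2) ^ M' ≤ (((bigLam ε₀)⁻¹) ^ 2) ^ n :=
      pow_le_pow_of_le_one hr0 hr1.le (le_max_right _ _)
    have h1 : T M σ₁ ≤ T M' σ₁ := hTmono (le_max_left _ _) σ₁
    have h2 : T M' σ₁ ≤ κ M' / 2 * Real.exp (2 * σ₁) := hbound M' σ₁
    have h3 : κ M' / 2 * Real.exp (2 * σ₁)
        = (K₀ / 2 * Real.exp (2 * σ₁)) * (((bigLam ε₀)⁻¹) ^ 2) ^ M' := by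
      rw [hκ_eq M']; ring
    have h4 : (K₀ / 2 * Real.exp (2 * σ₁)) * (((bigLam ε₀)⁻¹) ^ 2) ^ M'
        ≤ (K₀ / 2 * Real.exp (2 * σ₁)) * (δ / (K₀ / 2 * Real.exp (2 * σ₁) + 1)) :=
      mul_le_mul_of_nonneg_left (hrM'.trans hn.le) (by positivity)
    have h5 : (K₀ / 2 * Real.exp (2 * σ₁)) * (δ / (K₀ / 2 * Real.exp (2 * σ₁) + 1)) ≤ δ := by
      rw [mul_div_assoc', div_le_iff₀ (by positivity)]
      nlinarith [Real.exp_pos (2 * σ₁)]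
    linarith
  -- (7) conclusion
  intro n σ
  by_cases hn : n ≤ N
  · exact hz n hn σ
  · push Not at hn
    obtain ⟨j, hj⟩ : ∃ j : ℕ, n = N + 1 + (j : ℤ) := by
      refine ⟨(n - N - 1).toNat, ?_⟩
      rw [Int.toNat_of_nonneg (by omega)]
      ring
    have hsum : T (j + 1) σ = 0 := le_antisymm (hTle0 (j + 1) σ) (hT0 (j + 1) σ)
    have hterm : physEnergy ε₀ W (N + 1 + (j : ℤ)) σ = 0 := by
      have hsum' : ∑ i ∈ Finset.range (j + 1), physEnergy ε₀ W (N + 1 + (i : ℤ)) σ = 0 := by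
        simpa [hTdef] using hsum
      exact (Finset.sum_eq_zero_iff_of_nonneg (fun (i : ℕ) (_ : i ∈ Finset.range (j + 1)) =>
        physEnergy_nonneg ε₀ W (N + 1 + (i : ℤ)) σ)).1 hsum' j
        (Finset.mem_range.2 (Nat.lt_succ_self j))
    rw [hj]
    exact eq_zero_of_physEnergy_eq_zero hε hterm

/-- Packaged for the route vocabulary: among uniformly bounded admissible eternal solutions (any `ν̂ ≥ 0`) of a
cancelling table, the only one supported on a half-line of shells `k > N` is zero. -/
theorem no_oneSided_eternal (hε : 0 < ε₀) (hW : IsEternalVisc ε₀ νh α W) (hc : IsCancellingCoeff α)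
    (hU : UniformBound W) {N : ℤ} (hz : ∀ k : ℤ, k ≤ N → ∀ σ : ℝ, W k σ = 0) : W = fun _ _ => 0 :=
  funext fun n => funext fun σ => eq_zero_of_vanish_below hε hW hc hU hz n σ

end Summit.NavierStokesRegularity.NavierStokesRegularity.Cruxes.EternalViscousRate.DissipationEdge
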